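import Summits.BirchSwinnertonDyer.BirchSwinnertonDyer.Theorems.UniversalToricDescentDefectTransportModThreePTOfLambdaLe
import Summits.BirchSwinnertonDyer.BirchSwinnertonDyer.Theorems.UniversalToricDescentToricTransportModThreeStubRatSqueeze
import Summits.BirchSwinnertonDyer.BirchSwinnertonDyer.Theorems.UniversalToricDescentToricTransportModThreeFlatGlue
import Summits.BirchSwinnertonDyer.BirchSwinnertonDyer.Theses.SemiOrdinaryEisensteinDescent
import HarnessLib

/-!
# NODE «Eisenstein degree shadow» for crux A = `SigmaCongruenceAtThree` (stmt-BirchSwinnertonDyer-27120)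
# (crux-ideate lineage cruxidea-stmt-BirchSwinnertonDyer-27120-1, gen 6; cell `pub/bsd-wall`)

A (two-sided Σ-congruence of the BDP frames of the wild curve `E` and its `3`-congruent twin `E′`) is consumed by the route
`UniversalToricDescent` (UTD) ONLY through its parent ♭T≤ `DefectTransportModThreePT` (stmt-23042), and ♭T≤ only through the
ONE-SIDED λ-inequality `λ(𝓛^Σ_E) ≤ λ(𝓛^Σ_{E′})` (p706556). This node records the E′-FREE road to ♭T≤ that the 27120 idea pool
(8 cards, all ANALYTIC COMPARISONS of `f_E` with `f_{E′}`) does not contain: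

* piece E° `WildEisensteinDegreeAtThree` — the DEGREE-ONLY wild Eisenstein clause «`X_(∅,0)(E/K_∞)` torsion, `Ch·R₀⟦T⟧ = (g)`,
  `g` of norm profile `n`, frame `𝓛` of norm profile `m` ⟹ `m ≤ n`», i.e. `λ_an(E) ≤ λ_alg(E)` at `μ = 0` data — the T10 move
  («degree-only twin clause», UTD 22539) applied to the WILD curve. UNDECIDED (research). It is WEAKER than
  route SOED's crux E `SemiOrdinaryEisensteinDescent.WildSplitEisensteinInclusionAtThree` (stmt-20479, `Ch·R₀⟦T⟧ ⊆ (𝓛)`) and than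
  its rational form E_rat `WildRationalEisensteinInclusionAtThree` («`∃ k, 3^k·Ch·R₀⟦T⟧ ⊆ (𝓛)`», what a Λ[1/p]-valued
  Eisenstein-congruence engine outputs): `wildRational_of_soedE`, `wildDegree_of_wildRational` (PROVED, Gauss lemma for the prime
  `C 3` of `R₀⟦T⟧` + `firstUnitCoeff_le_of_dvd`).
* piece Tw° `TwinKolyvaginDegreeAtThree` — the degree shadow of the TWIN's Kolyvagin inclusion `(𝓛′) ⊆ Ch(E′)·R₀⟦T⟧`
  («`n′ ≤ m′`»); KNOWN for good-ordinary twins (BCS2025 Thm 4.2.1(b), tree fact), = route crux `TwinSplitIMCAtThree` (20214) in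
  degree currency otherwise; `twinDegree_of_twinKolyvaginInclusion` (PROVED) derives it from the typed inclusion Tw⊇.
* COMPOSITION `defectTransportModThreePT_of_thmB_of_wildDegree_of_twinDegree :
  hB → WildEisensteinDegreeAtThree → TwinKolyvaginDegreeAtThree → DefectTransportModThreePT` — ♭T≤ BY NAME (kernel-checked),
  A-FREE: Hsieh Thm. B (print, `hB`) gives `μ(𝓛) = 0`; UTD's landed one-sided algebraic transport `oneSidedTransport` (p698423) the
  generators `g, g′` with profiles `n = λ_alg(E)`, `n′ = λ_alg(E′)`; E° gives `m ≤ n`, Tw° gives `n′ ≤ m′`; `omega`.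
  Corollary `defectTransportModThreePT_of_thmB_of_soedE_of_twinIncl` keys it on SOED's E and Tw⊇ BY NAME (cross-route identity:
  UTD's A-chain 27120 → 23042 is bypassed by SOED 20479; conversely UTD's transport thesis is exactly the device that AVOIDS E).

TAGS (D-0171). E°: UNDECIDED · leaf ATTACKABLE only through SOED's lever (semi-ordinary GU(3,1) Eisenstein congruences,
Castella–Liu–Wan 2021, `p ≥ 3`, `π_p` never `p`-stabilised) ported to RAMIFIED `π_3` — SOED records 4 dead line births on E and
the obstructions (p-local Fourier–Jacobi coefficient mod 3 at supercuspidal `π_3`; (irred)/(dist) for `ξ` at `p = 3`; Hsieh `p ∤ 6`);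
BARRIER notes: every O6 curve is potentially SUPERSINGULAR at 3 (`j̃ = 0`), so no Hida/ordinary engine exists (gen-6 kill of the
nearly-ordinary untwist); E_rat/E° are blind to `μ`, which is supplied by print on both sides. Tw°: WEAKER than 20214 · KNOWN on
bucket A. hB: PRINT. Nothing here is progress on A itself; BSD is not proved for any curve by this file. No `sorry`, no new axiom,
no definition beyond the three `Prop`s, no banned option.

References: [GreenbergVatsal2000] Thm. (1.4), (1.5); [Hsieh2014] Thm. B; [CastellaLiuWan2021] = arXiv:2109.08375 Thm. 1.1,
§5.1 hypotheses; [Wan2020] = arXiv:1411.6352; [JetchevSkinnerWan2017] §7.4; [BurungaleCastellaSkinner2025] Thm. 4.2.1(b);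
[Washington1997] §7.1.
-/

noncomputable section

open scoped Classical

set_option linter.dupNamespace false
set_option autoImplicit false

namespace Summit.BirchSwinnertonDyer.BirchSwinnertonDyer.Cruxes.SigmaCongruenceAtThree.EisensteinDegreeShadow

open PowerSeries WeierstrassCurve NumberField IsDedekindDomain Field Polynomial
  Literature.NumberTheory.EllipticCurves
  Literature.NumberTheory.EllipticCurves.ModularForms
  Literature.NumberTheory.EllipticCurves.Rank1Residual
  Literature.NumberTheory.EllipticCurves.GreenbergSelmer
  Literature.NumberTheory.EllipticCurves.IwasawaAlgebra
  Summit.BirchSwinnertonDyer.Rank1Residual Summit.BirchSwinnertonDyer.Rank1Residual.X11b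
  Summit.BirchSwinnertonDyer.Rank1Residual.X11b.AcSelmer
  Summit.BirchSwinnertonDyer.Rank1Residual.Iwasawa
  Summit.BirchSwinnertonDyer.BirchSwinnertonDyer.Theorems
  Summit.BirchSwinnertonDyer.BirchSwinnertonDyer.Theorems.SchneiderFree
  Summit.BirchSwinnertonDyer.BirchSwinnertonDyer.Theorems.UniversalToricDescentDefectTransportModThreePTOfSigmaCongruence
  Summit.BirchSwinnertonDyer.BirchSwinnertonDyer.Theorems.UniversalToricDescentActDFlatGlue
  Summit.BirchSwinnertonDyer.BirchSwinnertonDyer.Cruxes.ToricTransportModThree.RatwallThinComb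
  Summit.BirchSwinnertonDyer.BirchSwinnertonDyer.Theses.UniversalToricDescent

/-! ### §1 The pieces (typed) -/

/-- **E° — degree-only wild Eisenstein clause at the additive split prime 3** (piece, UNDECIDED; WEAKER than SOED 20479 and than
E_rat below). Binders = UTD's wall `AdditiveSplitIMCInclusionAtThree` (20395) VERBATIM, then the torsion guard of SOED's E, then: for
every generator `g` of `Ch_Λ(X_(∅,0)(E/K_∞))·R₀⟦T⟧` with norm profile `n` and every norm profile `m` of the frame `𝓛`, `m ≤ n`
(`λ(𝓛) ≤ λ(X_(∅,0))`, the «⊆»/Eisenstein/lower-bound-on-Ш direction in DEGREE currency). -/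
def WildEisensteinDegreeAtThree : Prop :=
  ∀ (W : WeierstrassCurve ℚ) [W.IsElliptic] [W.IsGloballyMinimal] (N : ℕ) [NeZero N] (K : Type) [Field K] [NumberField K]
    (Dt : Literature.NumberTheory.EllipticCurves.ModularForms.ModularParametrizationData W N),
    Summit.BirchSwinnertonDyer.Rank1Residual.Additive.ClassO6 W 3 → W.HasSurjectiveModNGaloisRep 3 → W.analyticRank = 1 →
    W.conductorNorm ℤ = N → Literature.NumberTheory.EllipticCurves.IsImaginaryQuadratic K →
    Literature.NumberTheory.EllipticCurves.SatisfiesHeegnerHypothesis N K →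
    ∀ (κ : Literature.NumberTheory.EllipticCurves.ZpExtension K 3), κ.IsAnticyclotomic →
    ∀ (γ : Field.absoluteGaloisGroup K) [Fact (κ.IsTopGenerator γ)]
      (𝔭 : IsDedekindDomain.HeightOneSpectrum (NumberField.RingOfIntegers K)),
      ((3 : ℕ) : NumberField.RingOfIntegers K) ∈ 𝔭.asIdeal → 𝔭.asIdeal.ramificationIdx (NumberField.RingOfIntegers ℚ) = 1 →
      𝔭.asIdeal.inertiaDeg (NumberField.RingOfIntegers ℚ) = 1 →
    ∀ (𝔭' : IsDedekindDomain.HeightOneSpectrum (NumberField.RingOfIntegers K)),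
      ((3 : ℕ) : NumberField.RingOfIntegers K) ∈ 𝔭'.asIdeal → 𝔭' ≠ 𝔭 →
    ∀ (ι' : PadicAlgCl 3 ≃+* ℂ), Summit.BirchSwinnertonDyer.BirchSwinnertonDyer.Theorems.SchneiderFree.BranchInducesPrime 3 ι' 𝔭 →
    ∀ (ΩK : ℂ) (Ωp : ℂ_[3]) (L : Literature.NumberTheory.EllipticCurves.UnrSeries 3), ΩK ≠ 0 → Ωp ≠ 0 →
      Literature.NumberTheory.EllipticCurves.IsBDPLFunction ι' 𝔭 κ γ Dt.f ΩK Ωp L →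
      Module.IsTorsion (Literature.NumberTheory.EllipticCurves.IwasawaAlgebra 3)
        (Summit.BirchSwinnertonDyer.Rank1Residual.X11b.AcSelmer.XAc (W.baseChange K) 3 κ 𝔭' ∅ γ) →
      ∀ (g : Literature.NumberTheory.EllipticCurves.UnrSeries 3) (n m : ℕ),
        (Summit.BirchSwinnertonDyer.Rank1Residual.X11b.AcSelmer.XAc.charIdeal (W.baseChange K) 3 κ 𝔭' ∅ γ).map
            (PowerSeries.map (Summit.BirchSwinnertonDyer.Rank1Residual.X11b.Halves.toUnr 3)) = Ideal.span {g} →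
        (∀ i < n, ‖((PowerSeries.coeff i g : Literature.NumberTheory.EllipticCurves.unrIntegers 3) : ℂ_[3])‖ < 1) →
        ‖((PowerSeries.coeff n g : Literature.NumberTheory.EllipticCurves.unrIntegers 3) : ℂ_[3])‖ = 1 →
        (∀ i < m, ‖((PowerSeries.coeff i L : Literature.NumberTheory.EllipticCurves.unrIntegers 3) : ℂ_[3])‖ < 1) →
        ‖((PowerSeries.coeff m L : Literature.NumberTheory.EllipticCurves.unrIntegers 3) : ℂ_[3])‖ = 1 →
        m ≤ n

/-- **E_rat — the RATIONAL (Λ[1/3]) wild Eisenstein inclusion at 3** (piece, UNDECIDED; WEAKER than SOED 20479, STRONGER than E°):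
same binders and torsion guard, conclusion `∃ k, 3^k · Ch·R₀⟦T⟧ ⊆ (𝓛)` — the shape an Eisenstein-congruence engine delivers
(divisibility at height-one primes `≠ (p)`; blind to `μ`). -/
def WildRationalEisensteinInclusionAtThree : Prop :=
  ∀ (W : WeierstrassCurve ℚ) [W.IsElliptic] [W.IsGloballyMinimal] (N : ℕ) [NeZero N] (K : Type) [Field K] [NumberField K]
    (Dt : Literature.NumberTheory.EllipticCurves.ModularForms.ModularParametrizationData W N),
    Summit.BirchSwinnertonDyer.Rank1Residual.Additive.ClassO6 W 3 → W.HasSurjectiveModNGaloisRep 3 → W.analyticRank = 1 →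
    W.conductorNorm ℤ = N → Literature.NumberTheory.EllipticCurves.IsImaginaryQuadratic K →
    Literature.NumberTheory.EllipticCurves.SatisfiesHeegnerHypothesis N K →
    ∀ (κ : Literature.NumberTheory.EllipticCurves.ZpExtension K 3), κ.IsAnticyclotomic →
    ∀ (γ : Field.absoluteGaloisGroup K) [Fact (κ.IsTopGenerator γ)]
      (𝔭 : IsDedekindDomain.HeightOneSpectrum (NumberField.RingOfIntegers K)),
      ((3 : ℕ) : NumberField.RingOfIntegers K) ∈ 𝔭.asIdeal → 𝔭.asIdeal.ramificationIdx (NumberField.RingOfIntegers ℚ) = 1 →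
      𝔭.asIdeal.inertiaDeg (NumberField.RingOfIntegers ℚ) = 1 →
    ∀ (𝔭' : IsDedekindDomain.HeightOneSpectrum (NumberField.RingOfIntegers K)),
      ((3 : ℕ) : NumberField.RingOfIntegers K) ∈ 𝔭'.asIdeal → 𝔭' ≠ 𝔭 →
    ∀ (ι' : PadicAlgCl 3 ≃+* ℂ), Summit.BirchSwinnertonDyer.BirchSwinnertonDyer.Theorems.SchneiderFree.BranchInducesPrime 3 ι' 𝔭 →
    ∀ (ΩK : ℂ) (Ωp : ℂ_[3]) (L : Literature.NumberTheory.EllipticCurves.UnrSeries 3), ΩK ≠ 0 → Ωp ≠ 0 →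
      Literature.NumberTheory.EllipticCurves.IsBDPLFunction ι' 𝔭 κ γ Dt.f ΩK Ωp L →
      Module.IsTorsion (Literature.NumberTheory.EllipticCurves.IwasawaAlgebra 3)
        (Summit.BirchSwinnertonDyer.Rank1Residual.X11b.AcSelmer.XAc (W.baseChange K) 3 κ 𝔭' ∅ γ) →
      ∃ k : ℕ, ∀ x ∈ (Summit.BirchSwinnertonDyer.Rank1Residual.X11b.AcSelmer.XAc.charIdeal (W.baseChange K) 3 κ 𝔭' ∅ γ).map
            (PowerSeries.map (Summit.BirchSwinnertonDyer.Rank1Residual.X11b.Halves.toUnr 3)),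
        ((3 : ℕ) : Literature.NumberTheory.EllipticCurves.UnrSeries 3) ^ k * x ∈ Ideal.span {L}

/-- **Tw⊇ — the twin's Kolyvagin inclusion** (piece; KNOWN for good-ordinary twins: BCS2025 Thm. 4.2.1(b); = route crux 20214
`TwinSplitIMCAtThree` weakened to one inclusion otherwise). Binders = UTD's `ToricTransportModThree` prefix (wild + twin data)
VERBATIM; conclusion at every twin frame `𝓛′`: `(𝓛′) ⊆ Ch_Λ(X_(∅,0)(E′/K_∞))·R₀⟦T⟧`. -/
def TwinKolyvaginInclusionAtThree : Prop :=
  ∀ (W : WeierstrassCurve ℚ) [W.IsElliptic] [W.IsGloballyMinimal] (W' : WeierstrassCurve ℚ) [W'.IsElliptic] [W'.IsGloballyMinimal]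
    (N N' : ℕ) [NeZero N] [NeZero N'] (K : Type) [Field K] [NumberField K]
    (Dt : Literature.NumberTheory.EllipticCurves.ModularForms.ModularParametrizationData W N)
    (Dt' : Literature.NumberTheory.EllipticCurves.ModularForms.ModularParametrizationData W' N'),
    Summit.BirchSwinnertonDyer.Rank1Residual.Additive.ClassO6 W 3 → W.HasSurjectiveModNGaloisRep 3 → W.analyticRank = 1 →
    W.conductorNorm ℤ = N → Summit.BirchSwinnertonDyer.Rank1Residual.O6.ModPCongruent W' W 3 →
    ¬ Literature.NumberTheory.EllipticCurves.Rank1Residual.Addv W' 3 → W'.conductorNorm ℤ = N' →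
    Literature.NumberTheory.EllipticCurves.IsImaginaryQuadratic K →
    Literature.NumberTheory.EllipticCurves.SatisfiesHeegnerHypothesis N K →
    Literature.NumberTheory.EllipticCurves.SatisfiesHeegnerHypothesis N' K →
    ∀ (κ : Literature.NumberTheory.EllipticCurves.ZpExtension K 3), κ.IsAnticyclotomic →
    ∀ (γ : Field.absoluteGaloisGroup K) [Fact (κ.IsTopGenerator γ)]
      (𝔭 : IsDedekindDomain.HeightOneSpectrum (NumberField.RingOfIntegers K)),
      ((3 : ℕ) : NumberField.RingOfIntegers K) ∈ 𝔭.asIdeal → 𝔭.asIdeal.ramificationIdx (NumberField.RingOfIntegers ℚ) = 1 →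
      𝔭.asIdeal.inertiaDeg (NumberField.RingOfIntegers ℚ) = 1 →
    ∀ (𝔭' : IsDedekindDomain.HeightOneSpectrum (NumberField.RingOfIntegers K)),
      ((3 : ℕ) : NumberField.RingOfIntegers K) ∈ 𝔭'.asIdeal → 𝔭' ≠ 𝔭 →
    ∀ (ι' : PadicAlgCl 3 ≃+* ℂ), Summit.BirchSwinnertonDyer.BirchSwinnertonDyer.Theorems.SchneiderFree.BranchInducesPrime 3 ι' 𝔭 →
    ∀ (ΩK' : ℂ) (Ωp' : ℂ_[3]) (L' : Literature.NumberTheory.EllipticCurves.UnrSeries 3), ΩK' ≠ 0 → Ωp' ≠ 0 →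
      Literature.NumberTheory.EllipticCurves.IsBDPLFunction ι' 𝔭 κ γ Dt'.f ΩK' Ωp' L' →
      Ideal.span {L'} ≤ (Summit.BirchSwinnertonDyer.Rank1Residual.X11b.AcSelmer.XAc.charIdeal (W'.baseChange K) 3 κ 𝔭' ∅ γ).map
          (PowerSeries.map (Summit.BirchSwinnertonDyer.Rank1Residual.X11b.Halves.toUnr 3))

/-- **Tw° — degree shadow of the twin's Kolyvagin inclusion** (piece; WEAKER than Tw⊇ and than 20214; KNOWN on bucket A): same
binders; for every generator `g′` of `Ch(E′)·R₀⟦T⟧` with norm profile `n′` and every norm profile `m′` of `𝓛′`, `n′ ≤ m′`. -/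
def TwinKolyvaginDegreeAtThree : Prop :=
  ∀ (W : WeierstrassCurve ℚ) [W.IsElliptic] [W.IsGloballyMinimal] (W' : WeierstrassCurve ℚ) [W'.IsElliptic] [W'.IsGloballyMinimal]
    (N N' : ℕ) [NeZero N] [NeZero N'] (K : Type) [Field K] [NumberField K]
    (Dt : Literature.NumberTheory.EllipticCurves.ModularForms.ModularParametrizationData W N)
    (Dt' : Literature.NumberTheory.EllipticCurves.ModularForms.ModularParametrizationData W' N'),
    Summit.BirchSwinnertonDyer.Rank1Residual.Additive.ClassO6 W 3 → W.HasSurjectiveModNGaloisRep 3 → W.analyticRank = 1 →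
    W.conductorNorm ℤ = N → Summit.BirchSwinnertonDyer.Rank1Residual.O6.ModPCongruent W' W 3 →
    ¬ Literature.NumberTheory.EllipticCurves.Rank1Residual.Addv W' 3 → W'.conductorNorm ℤ = N' →
    Literature.NumberTheory.EllipticCurves.IsImaginaryQuadratic K →
    Literature.NumberTheory.EllipticCurves.SatisfiesHeegnerHypothesis N K →
    Literature.NumberTheory.EllipticCurves.SatisfiesHeegnerHypothesis N' K →
    ∀ (κ : Literature.NumberTheory.EllipticCurves.ZpExtension K 3), κ.IsAnticyclotomic →
    ∀ (γ : Field.absoluteGaloisGroup K) [Fact (κ.IsTopGenerator γ)]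
      (𝔭 : IsDedekindDomain.HeightOneSpectrum (NumberField.RingOfIntegers K)),
      ((3 : ℕ) : NumberField.RingOfIntegers K) ∈ 𝔭.asIdeal → 𝔭.asIdeal.ramificationIdx (NumberField.RingOfIntegers ℚ) = 1 →
      𝔭.asIdeal.inertiaDeg (NumberField.RingOfIntegers ℚ) = 1 →
    ∀ (𝔭' : IsDedekindDomain.HeightOneSpectrum (NumberField.RingOfIntegers K)),
      ((3 : ℕ) : NumberField.RingOfIntegers K) ∈ 𝔭'.asIdeal → 𝔭' ≠ 𝔭 →
    ∀ (ι' : PadicAlgCl 3 ≃+* ℂ), Summit.BirchSwinnertonDyer.BirchSwinnertonDyer.Theorems.SchneiderFree.BranchInducesPrime 3 ι' 𝔭 →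
    ∀ (ΩK' : ℂ) (Ωp' : ℂ_[3]) (L' : Literature.NumberTheory.EllipticCurves.UnrSeries 3), ΩK' ≠ 0 → Ωp' ≠ 0 →
      Literature.NumberTheory.EllipticCurves.IsBDPLFunction ι' 𝔭 κ γ Dt'.f ΩK' Ωp' L' →
      ∀ (g' : Literature.NumberTheory.EllipticCurves.UnrSeries 3) (n' m' : ℕ),
        (Summit.BirchSwinnertonDyer.Rank1Residual.X11b.AcSelmer.XAc.charIdeal (W'.baseChange K) 3 κ 𝔭' ∅ γ).map
            (PowerSeries.map (Summit.BirchSwinnertonDyer.Rank1Residual.X11b.Halves.toUnr 3)) = Ideal.span {g'} →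
        (∀ i < n', ‖((PowerSeries.coeff i g' : Literature.NumberTheory.EllipticCurves.unrIntegers 3) : ℂ_[3])‖ < 1) →
        ‖((PowerSeries.coeff n' g' : Literature.NumberTheory.EllipticCurves.unrIntegers 3) : ℂ_[3])‖ = 1 →
        (∀ i < m', ‖((PowerSeries.coeff i L' : Literature.NumberTheory.EllipticCurves.unrIntegers 3) : ℂ_[3])‖ < 1) →
        ‖((PowerSeries.coeff m' L' : Literature.NumberTheory.EllipticCurves.unrIntegers 3) : ℂ_[3])‖ = 1 →
        n' ≤ m'

/-! ### §2 The proved edges between the pieces -/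

/-- SOED's crux E (20479, full inclusion) ⟹ E_rat (`k = 0`). -/
theorem wildRational_of_soedE
    (hE : Summit.BirchSwinnertonDyer.BirchSwinnertonDyer.Theses.SemiOrdinaryEisensteinDescent.WildSplitEisensteinInclusionAtThree) :
    WildRationalEisensteinInclusionAtThree := by
  intro W _ _ N _ K _ _ Dt hO6 hsurj hr hN hK hHe κ hκ γ _ 𝔭 h𝔭 he hf 𝔭' h𝔭' hne ι' hbr ΩK Ωp L hΩK hΩp hL hT
  refine ⟨0, fun x hx ↦ ?_⟩
  rw [pow_zero, one_mul]
  exact hE W N K Dt hO6 hsurj hr hN hK hHe κ hκ γ 𝔭 h𝔭 he hf 𝔭' h𝔭' hne ι' hbr ΩK Ωp L hΩK hΩp hL hT hx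

/-- E_rat ⟹ E°: `3^k·g ∈ (𝓛)` with `‖𝓛_m‖ = 1` gives `𝓛 ∣ g` (Gauss lemma for the prime `C 3` of `R₀⟦T⟧`, `3 ∤ 𝓛`), and the first
unit coefficient is monotone under divisibility (`firstUnitCoeff_le_of_dvd`). [folklore; Washington1997 §7.1] -/
theorem wildDegree_of_wildRational (hR : WildRationalEisensteinInclusionAtThree) : WildEisensteinDegreeAtThree := by
  intro W _ _ N _ K _ _ Dt hO6 hsurj hr hN hK hHe κ hκ γ _ 𝔭 h𝔭 he hf 𝔭' h𝔭' hne ι' hbr ΩK Ωp L hΩK hΩp hL hT g n m hg hglt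
    hgeq hLlt hLeq
  haveI : Fact (Nat.Prime 3) := ⟨Nat.prime_three⟩
  obtain ⟨k, hk⟩ := hR W N K Dt hO6 hsurj hr hN hK hHe κ hκ γ 𝔭 h𝔭 he hf 𝔭' h𝔭' hne ι' hbr ΩK Ωp L hΩK hΩp hL hT
  have hgmem : g ∈ (XAc.charIdeal (W.baseChange K) 3 κ 𝔭' ∅ γ).map (PowerSeries.map (Halves.toUnr 3)) := by
    rw [hg]; exact Ideal.mem_span_singleton_self g
  have hdvd : L ∣ ((3 : ℕ) : UnrSeries 3) ^ k * g := Ideal.mem_span_singleton.mp (hk g hgmem)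
  rw [← map_natCast (PowerSeries.C (R := unrIntegers 3))] at hdvd
  exact firstUnitCoeff_le_of_dvd
    (dvd_of_dvd_prime_pow_mul prime_C_three (not_C_three_dvd_of_norm_coeff_eq_one hLeq) k hdvd) hLlt hgeq

/-- Tw⊇ ⟹ Tw°: `𝓛′ ∈ (g′)` is `g′ ∣ 𝓛′`, and `firstUnitCoeff_le_of_dvd`. -/
theorem twinDegree_of_twinKolyvaginInclusion (hI : TwinKolyvaginInclusionAtThree) : TwinKolyvaginDegreeAtThree := by
  intro W _ _ W' _ _ N N' _ _ K _ _ Dt Dt' hO6 hsurj hr hN hcong hadd hN' hK hHe hHe' κ hκ γ _ 𝔭 h𝔭 he hf 𝔭' h𝔭' hne ι' hbr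
    ΩK' Ωp' L' hΩK' hΩp' hL' g' n' m' hg' hglt' hgeq' hLlt' hLeq'
  haveI : Fact (Nat.Prime 3) := ⟨Nat.prime_three⟩
  have hle := hI W W' N N' K Dt Dt' hO6 hsurj hr hN hcong hadd hN' hK hHe hHe' κ hκ γ 𝔭 h𝔭 he hf 𝔭' h𝔭' hne ι' hbr ΩK' Ωp' L'
    hΩK' hΩp' hL'
  have hmem : L' ∈ Ideal.span {g'} := hg' ▸ hle (Ideal.mem_span_singleton_self L')
  exact firstUnitCoeff_le_of_dvd (Ideal.mem_span_singleton.mp hmem) hglt' hLeq'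

/-! ### §3 COMPOSITION: ♭T≤ BY NAME, A-free -/

/-- **♭T≤ `DefectTransportModThreePT` (stmt-23042) BY NAME from Hsieh Thm. B (print), E° and Tw° — WITHOUT A (27120).**
`μ(𝓛) = 0` from `hB` (`self_forall_isBDPLFunction_coeff_norm_eq_one`), `μ(𝓛′) = 0` is ♭T≤'s own hypothesis; UTD's landed
`oneSidedTransport` (p698423) supplies the generators `g, g′` with norm profiles `n = λ_alg(E)`, `n′ = λ_alg(E′)` from ♭T≤'s binders
(torsion of `X_(∅,0)(E)` and the wall inclusion at `𝓛` included); E° gives `m ≤ n`, Tw° gives `n′ ≤ m′`, hence `n′ + m ≤ n + m′`.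
[cite: GreenbergVatsal2000, Thm. (1.4)] [cite: Hsieh2014, Thm. B] -/
theorem defectTransportModThreePT_of_thmB_of_wildDegree_of_twinDegree
    (hB : Hsieh2014.thmB_exists_isHsiehLFunction_coeff_norm_eq_one_unrPeriod_anyLevel)
    (hE : WildEisensteinDegreeAtThree) (hTw : TwinKolyvaginDegreeAtThree) :
    DefectTransportModThreePT := by
  unfold DefectTransportModThreePT
  intro hPT hPT2 W _ _ W' _ _ N N' _ _ K _ _ Dt Dt' hO6 hsurj hr hN hcong hadd hN' hK hHe hHe' hfinE κ hκ γ _ 𝔭 𝔭' h𝔭 he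
    hf h𝔭' hne ι' hbr hT ΩK Ωp L hΩK hΩp hL hle ΩK' Ωp' L' hΩK' hΩp' hL' hi'
  haveI : Fact (Nat.Prime 3) := ⟨Nat.prime_three⟩
  -- `μ(𝓛) = 0` (print) and the two norm profiles
  have hi : ∃ i : ℕ, ‖((PowerSeries.coeff i L : unrIntegers 3) : ℂ_[3])‖ = 1 :=
    UniversalToricDescentSelfMuZero.self_forall_isBDPLFunction_coeff_norm_eq_one hB W N K Dt hO6 hsurj hr hN hK hHe κ hκ γ 𝔭
      h𝔭 he hf 𝔭' h𝔭' hne ι' hbr ΩK Ωp L hΩK hΩp hL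
  obtain ⟨m, hm⟩ := UniversalToricDescentSelfMuZero.exists_normProfile_of_exists_coeff_norm_eq_one hi
  obtain ⟨m', hm'⟩ := UniversalToricDescentSelfMuZero.exists_normProfile_of_exists_coeff_norm_eq_one hi'
  -- the algebraic data (landed one-sided transport)
  obtain ⟨T, c, s, s', hTS, hdata, ⟨g, hg, hglt, hgeq⟩, hT', ⟨g', hg', hglt', hgeq'⟩, -⟩ :=
    oneSidedTransport hPT hPT2 W W' N N' K hO6 hsurj hr hN hcong hadd hN' hK hHe hHe' hfinE κ hκ γ 𝔭' h𝔭' hT L hle hi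
  -- E°: `m ≤ n`; Tw°: `n′ ≤ m′`
  have hmn := hE W N K Dt hO6 hsurj hr hN hK hHe κ hκ γ 𝔭 h𝔭 he hf 𝔭' h𝔭' hne ι' hbr ΩK Ωp L hΩK hΩp hL hT g _ m hg hglt
    hgeq hm.1 hm.2
  have hn'm' := hTw W W' N N' K Dt Dt' hO6 hsurj hr hN hcong hadd hN' hK hHe hHe' κ hκ γ 𝔭 h𝔭 he hf 𝔭' h𝔭' hne ι' hbr ΩK' Ωp'
    L' hΩK' hΩp' hL' g' _ m' hg' hglt' hgeq' hm'.1 hm'.2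
  exact ⟨g, g', _, m, _, m', hg, hg', ⟨hglt, hgeq⟩, hm, ⟨hglt', hgeq'⟩, hm', by omega⟩

/-- **Cross-route corollary: ♭T≤ BY NAME from print + SOED's crux E (20479) + the twin's Kolyvagin inclusion Tw⊇.** UTD's A-chain
(27120 → 23042) is bypassed by SOED 20479: the two routes' research walls at the additive split `3` are the two halves of ONE main
conjecture, and UTD's transport thesis is precisely the device that trades E for {A, 20214, B}. -/
theorem defectTransportModThreePT_of_thmB_of_soedE_of_twinIncl
    (hB : Hsieh2014.thmB_exists_isHsiehLFunction_coeff_norm_eq_one_unrPeriod_anyLevel)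
    (hE : Summit.BirchSwinnertonDyer.BirchSwinnertonDyer.Theses.SemiOrdinaryEisensteinDescent.WildSplitEisensteinInclusionAtThree)
    (hI : TwinKolyvaginInclusionAtThree) : DefectTransportModThreePT :=
  defectTransportModThreePT_of_thmB_of_wildDegree_of_twinDegree hB (wildDegree_of_wildRational (wildRational_of_soedE hE))
    (twinDegree_of_twinKolyvaginInclusion hI)

/-- Audit anchor: the composition's conclusion is the route decl ♭T≤ BY (fully qualified) NAME. -/
example (hB : Hsieh2014.thmB_exists_isHsiehLFunction_coeff_norm_eq_one_unrPeriod_anyLevel)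
    (hE : WildEisensteinDegreeAtThree) (hTw : TwinKolyvaginDegreeAtThree) :
    Summit.BirchSwinnertonDyer.BirchSwinnertonDyer.Theses.UniversalToricDescent.DefectTransportModThreePT :=
  defectTransportModThreePT_of_thmB_of_wildDegree_of_twinDegree hB hE hTw

/-! ### §5 Inside UTD's own hypotheses the degree shadow IS SOED's crux E (pricing identity, kernel half)

Given UTD's wall `AdditiveSplitIMCInclusionAtThree` (20395: `(𝓛) ⊆ Ch·R₀⟦T⟧`) and print (Hsieh Thm B ⟹ `μ(𝓛) = 0`), the degree-only
clause E° is not weaker than SOED's full Eisenstein inclusion E (20479): `𝓛 = g·h`, and `λ(𝓛) ≤ λ(g)` forces `h ∈ R₀⟦T⟧ˣ`. With §2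
(E ⟹ E_rat ⟹ E°) this makes E° ⟺ E modulo (hB, 20395) — both of which are binders/inputs of ♭T≤'s context. So the beyond-print
content that crux A (27120) supplies to UTD through ♭T≤ is exactly SOED's crux E at the same frames (and, by SOED's landed pinch
`WildSplitEisensteinInclusionAtThreeValueAtOnePinch.cruxOffZero_of_kolyvaginInclusion_of_valueAtOne`, exactly the value-at-𝟙
statement E_𝟙^V = SOED 26610 on frames with `𝓛(𝟙) ≠ 0`). -/

/-- A divisor of a `μ = 0` series has a norm profile no later (cf. CHL's `exists_firstUnitCoeff_le_of_dvd`; re-proved here to keep the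
import closure inside UTD + SOED). [cite: Washington1997, §7.1] -/
theorem exists_normProfile_le_of_dvd {F G : UnrSeries 3} {b : ℕ} (h : F ∣ G)
    (hG : ‖((PowerSeries.coeff b G : unrIntegers 3) : ℂ_[3])‖ = 1) :
    ∃ a : ℕ, a ≤ b ∧ (∀ i < a, ‖((PowerSeries.coeff i F : unrIntegers 3) : ℂ_[3])‖ < 1) ∧
      ‖((PowerSeries.coeff a F : unrIntegers 3) : ℂ_[3])‖ = 1 := by
  haveI : Fact (Nat.Prime 3) := ⟨Nat.prime_three⟩
  have hex : ∃ a : ℕ, ‖((PowerSeries.coeff a F : unrIntegers 3) : ℂ_[3])‖ = 1 := by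
    by_contra hne
    have hlt : ∀ i < b + 1, ‖((PowerSeries.coeff i F : unrIntegers 3) : ℂ_[3])‖ < 1 := fun i _ ↦
      lt_of_le_of_ne (Halves.norm_coe_unrIntegers_le_one 3 _) (fun h1 ↦ hne ⟨i, h1⟩)
    have hle : b + 1 ≤ b := firstUnitCoeff_le_of_dvd h hlt hG
    omega
  obtain ⟨a, halt, haeq⟩ := UniversalToricDescentSelfMuZero.exists_normProfile_of_exists_coeff_norm_eq_one hex
  exact ⟨a, firstUnitCoeff_le_of_dvd h halt hG, halt, haeq⟩

/-- **Algebra of the pinch in degree currency.** Wall direction `(L) ⊆ (g)`, `g` with no norm-one coefficient below `n`, `L` with a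
norm-one coefficient at `m`, and E°'s `m ≤ n` force `(g) = (L)`. [cite: Washington1997, §7.1] -/
theorem span_eq_span_of_span_le_of_degree_le {g L : UnrSeries 3} {n m : ℕ}
    (hKo : Ideal.span ({L} : Set (UnrSeries 3)) ≤ Ideal.span {g})
    (hglt : ∀ i < n, ‖((PowerSeries.coeff i g : unrIntegers 3) : ℂ_[3])‖ < 1)
    (hLeq : ‖((PowerSeries.coeff m L : unrIntegers 3) : ℂ_[3])‖ = 1) (hmn : m ≤ n) :
    Ideal.span ({g} : Set (UnrSeries 3)) = Ideal.span {L} := by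
  haveI : Fact (Nat.Prime 3) := ⟨Nat.prime_three⟩
  have hdvd : g ∣ L := Ideal.mem_span_singleton.mp (hKo (Ideal.mem_span_singleton_self L))
  have hnm : n ≤ m := firstUnitCoeff_le_of_dvd hdvd hglt hLeq
  obtain rfl : m = n := le_antisymm hmn hnm
  exact UniversalToricDescentNormProfile.span_eq_span_of_dvd_of_normProfile hdvd hglt hLeq

/-- **hB ∧ UTD's wall (20395) ∧ E° ⟹ SOED's crux E (20479), BY NAME.** With §2 (`wildDegree_of_wildRational ∘ wildRational_of_soedE`:
E ⟹ E°) the degree shadow and SOED's Eisenstein inclusion are EQUIVALENT modulo print and UTD's Kolyvagin wall. Nothing is asserted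
about hB, the wall or E°; BSD is not proved by this. [cite: Washington1997, §7.1 and §13.2] [cite: Hsieh2014, Thm. B] -/
theorem soedE_of_thmB_of_wall_of_wildDegree
    (hB : Hsieh2014.thmB_exists_isHsiehLFunction_coeff_norm_eq_one_unrPeriod_anyLevel)
    (hKo : Summit.BirchSwinnertonDyer.BirchSwinnertonDyer.Theses.UniversalToricDescent.AdditiveSplitIMCInclusionAtThree)
    (hE : WildEisensteinDegreeAtThree) :
    Summit.BirchSwinnertonDyer.BirchSwinnertonDyer.Theses.SemiOrdinaryEisensteinDescent.WildSplitEisensteinInclusionAtThree := by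
  intro W _ _ N _ K _ _ Dt hO6 hsurj hr hN hK hHe κ hκ γ _ 𝔭 h𝔭 he hf 𝔭' h𝔭' hne ι' hbr ΩK Ωp L hΩK hΩp hL hT
  haveI : Fact (Nat.Prime 3) := ⟨Nat.prime_three⟩
  -- `μ(𝓛) = 0` from print, and a norm profile `m` of `𝓛`
  have hi : ∃ i : ℕ, ‖((PowerSeries.coeff i L : unrIntegers 3) : ℂ_[3])‖ = 1 :=
    UniversalToricDescentSelfMuZero.self_forall_isBDPLFunction_coeff_norm_eq_one hB W N K Dt hO6 hsurj hr hN hK hHe κ hκ γ 𝔭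
      h𝔭 he hf 𝔭' h𝔭' hne ι' hbr ΩK Ωp L hΩK hΩp hL
  obtain ⟨m, hLlt, hLeq⟩ := UniversalToricDescentSelfMuZero.exists_normProfile_of_exists_coeff_norm_eq_one hi
  -- UTD's wall at this frame
  have hwall := hKo W N K Dt hO6 hsurj hr hN hK hHe κ hκ γ 𝔭 h𝔭 he hf 𝔭' h𝔭' hne ι' hbr ΩK Ωp L hΩK hΩp hL
  -- a generator `g` of `Ch_Λ(X_(∅,0))·R₀⟦T⟧` (`Λ` is a UFD: `charIdeal_isPrincipal_holds`)
  have hP : (XAc.charIdeal (W.baseChange K) 3 κ 𝔭' ∅ γ).IsPrincipal :=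
    charIdeal_isPrincipal_holds 3 (XAc (W.baseChange K) 3 κ 𝔭' ∅ γ)
  obtain ⟨f, hf'⟩ := hP
  rw [Ideal.submodule_span_eq] at hf'
  have hg : (XAc.charIdeal (W.baseChange K) 3 κ 𝔭' ∅ γ).map (PowerSeries.map (Halves.toUnr 3)) =
      Ideal.span {PowerSeries.map (Halves.toUnr 3) f} := by
    rw [hf', CongruenceLimit.map_span_singleton_powerSeries]
  rw [hg] at hwall ⊢
  have hdvd : PowerSeries.map (Halves.toUnr 3) f ∣ L :=
    Ideal.mem_span_singleton.mp (hwall (Ideal.mem_span_singleton_self L))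
  -- `g` has a norm profile `n` (a divisor of the `μ = 0` series `𝓛`)
  obtain ⟨n, -, hglt, hgeq⟩ := exists_normProfile_le_of_dvd hdvd hLeq
  -- E°: `m ≤ n`
  have hmn : m ≤ n := hE W N K Dt hO6 hsurj hr hN hK hHe κ hκ γ 𝔭 h𝔭 he hf 𝔭' h𝔭' hne ι' hbr ΩK Ωp L hΩK hΩp hL hT _ n m hg
    hglt hgeq hLlt hLeq
  exact (span_eq_span_of_span_le_of_degree_le hwall hglt hLeq hmn).le

/-- Audit anchor: SOED's crux E concluded BY (fully qualified) NAME from print + UTD's wall + E°. -/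
example (hB : Hsieh2014.thmB_exists_isHsiehLFunction_coeff_norm_eq_one_unrPeriod_anyLevel)
    (hKo : Summit.BirchSwinnertonDyer.BirchSwinnertonDyer.Theses.UniversalToricDescent.AdditiveSplitIMCInclusionAtThree)
    (hE : WildEisensteinDegreeAtThree) :
    Summit.BirchSwinnertonDyer.BirchSwinnertonDyer.Theses.SemiOrdinaryEisensteinDescent.WildSplitEisensteinInclusionAtThree :=
  soedE_of_thmB_of_wall_of_wildDegree hB hKo hE

end Summit.BirchSwinnertonDyer.BirchSwinnertonDyer.Cruxes.SigmaCongruenceAtThree.EisensteinDegreeShadow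

end
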